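import Summits.CriticalPhenomena.PercolationContinuityZ3.Theorems.PercNearOneGluingNoHeavyQuantSliceConeForm
import Summits.CriticalPhenomena.PercolationContinuityZ3.Theorems.PercNearOneGluingNoHeavyQuantSliceClosureBlobs
import HarnessLib

/-!
# QUANT lane R8, T-DEC: BLOB-DEC(k) for every k from the WINDOW form of slice closure (replacing the route through the refuted
# two-layer Conjecture SL), hence from `ConvClosedT`

builds on p205010 (kernel theorem, internal audit signed; external expert review pending)

Support file (`--supports stmt-CriticalPhenomena-4575`), QUANT lane lead seat prim-quant-lead (gen 22), rung R8 of
`run/shared/lean/prim/quant/LADDER.md`.  Theorems only, standard axioms, no sorries.  Continues `…QuantSliceConeForm` (lead g22: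
`@[conjecture] LawDec.SliceClosedWindowT`, `@[conjecture] LawDec.ConvClosedT`, `sliceClosedWindowT_of_convClosedT`) and census-2 g53's
`…QuantSliceClosure` / `…QuantSliceClosureBlobs` (`blobDEC_of_sliceClosed`, `blobDEC_on_of_sliceClosed`).

WHY.  Census-2 g53 reduced BLOB-DEC(k) ∀k (DEC-TAMP-G50 §3.7: the count law of k independent heavy blobs is DEC(j′) at every layer) to
Conjecture SL (`LawDec.SliceClosed`) by induction on k — but SL is FALSE (census-2 g54, `not_sliceClosed`, p301229).  The induction itself
carries DEC at EVERY layer for the (k−1)-blob law, so it re-runs verbatim from the WINDOW form `SliceClosedWindowT` (DEC at every layer of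
`[j′−a, j′]` ⟹ the slice is DEC at `j′`), which is the replacement conjecture of record (README V245) and a consequence of `ConvClosedT`.
This file records that: the k-blob route to BLOB-DEC is intact.

* **`LawDec.blobDEC_of_sliceClosedWindowT : SliceClosedWindowT → ∀ x ∈ (0,1), ∀ blob lists (sizes ≥ 1, gates in [x,1)), ∀ j′, DECAt x j′ (blobTop l) (blobLaw l)`.**
* `LawDec.blobDEC_on_of_sliceClosedWindowT` — the same in the product-Bernoulli form `blobLawOn`.
* `LawDec.blobDEC_of_convClosedT`, `LawDec.blobDEC_on_of_convClosedT` — from `ConvClosedT`.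

[this work]; DEC rules ARCH-TREES-G49 §2.2 / DEC-TAMP-G50 §3.1 (this lane).  The gluing rows served [cite: KozmaNitzan2024, Conjecture 3 (p. 15)];
product measure [cite: Grimmett1999, §1.3 p. 10].
-/

noncomputable section

namespace Summit.CriticalPhenomena.PercolationContinuityZ3.Theorems

namespace Quant

open Finset

namespace LawDec

/-- **BLOB-DEC(k) FOR EVERY k FROM THE WINDOW FORM OF SLICE CLOSURE.**  If `SliceClosedWindowT` holds then, for every floor `0 < x < 1`
and every finite list of blobs with sizes `≥ 1` and gates in `[x, 1)`, the blob law is DEC(j′) at floor `x` for EVERY layer `j′`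
(layers `≥ Σaᵢ` by Theorem A; the others by the window form applied to the tail law, which is DEC at every layer by induction).
Same induction as census-2 g53's `blobDEC_of_sliceClosed`, with the (refuted) two-layer hypothesis replaced by the window. [this work] -/
theorem blobDEC_of_sliceClosedWindowT (hW : SliceClosedWindowT) (x : ℝ) (hx0 : 0 < x) (hx1 : x < 1) :
    ∀ (l : List (ℕ × ℝ)), (∀ p ∈ l, 1 ≤ p.1 ∧ x ≤ p.2 ∧ p.2 < 1) → ∀ j', DECAt x j' (blobTop l) (blobLaw l) := by
  intro l
  induction l with
  | nil => exact fun _ j' => decAt_blobLaw_nil x j'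
  | cons p l ih =>
    intro hl j'
    have hp := hl p (by simp)
    have hl' : ∀ q ∈ l, 1 ≤ q.1 ∧ x ≤ q.2 ∧ q.2 < 1 := fun q hq => hl q (by simp [hq])
    have ih' := ih hl'
    have hgates : ∀ q ∈ l, 0 ≤ q.2 ∧ q.2 ≤ 1 := fun q hq => ⟨hx0.le.trans (hl' q hq).2.1, (hl' q hq).2.2.le⟩
    have hgates' : ∀ q ∈ p :: l, 0 ≤ q.2 ∧ q.2 ≤ 1 := fun q hq => ⟨hx0.le.trans (hl q hq).2.1, (hl q hq).2.2.le⟩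
    by_cases hj : j' < blobTop l + p.1
    · -- a genuine layer of the sliced law: the window form, all layers of the tail law by induction
      have key := hW x p.2 (blobMean l) (blobTop l) p.1 j' (blobLaw l) hx0 hx1 hp.2.1 hp.2.2.le hp.1 (blobLaw_nonneg l hgates)
        (fun h hh => blobLaw_eq_zero l h hh) (sum_blobLaw l) hj
        (fun j'' _ _ => by
          have h := ih' j''
          rw [decAt_iff_decAtT, sum_mul_blobLaw] at h
          exact h)
      show DECAt x j' (blobTop l + p.1) (slice (blobLaw l) p.1 p.2)
      rw [decAt_iff_decAtT, sum_mul_slice (blobLaw l) p.1 p.2 (blobTop l) (fun h hh => blobLaw_eq_zero l h hh) (sum_blobLaw l),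
        sum_mul_blobLaw]
      exact key
    · -- layers at or above the top: Theorem A
      have htop' : ∀ h, 0 < blobLaw (p :: l) h →
          x * (h : ℝ) ≤ ∑ k ∈ Finset.range (blobTop (p :: l) + 1), (k : ℝ) * blobLaw (p :: l) k := by
        intro h hh
        rw [sum_mul_blobLaw]
        have hle : h ≤ blobTop (p :: l) := by
          by_contra hlt
          exact absurd (blobLaw_eq_zero (p :: l) h (not_le.1 hlt)) (ne_of_gt hh)
        have := floor_mul_blobTop_le x (p :: l) (fun q hq => (hl q hq).2.1)
        have hxh : x * (h : ℝ) ≤ x * (blobTop (p :: l) : ℝ) := mul_le_mul_of_nonneg_left (by exact_mod_cast hle) hx0.le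
        linarith
      exact decAt_of_top_le (blobTop (p :: l)) (blobLaw (p :: l)) (blobLaw_nonneg (p :: l) hgates')
        (fun h hh => blobLaw_eq_zero (p :: l) h hh) (sum_blobLaw (p :: l)) x hx1 htop' j' (not_lt.1 hj)

/-- **BLOB-DEC(k) ∀k, product-Bernoulli form, from the window form.** [this work] -/
theorem blobDEC_on_of_sliceClosedWindowT {ι : Type} [DecidableEq ι] (hW : SliceClosedWindowT) (x : ℝ) (hx0 : 0 < x) (hx1 : x < 1)
    (s : Finset ι) (a : ι → ℕ) (p : ι → ℝ) (hs : ∀ i ∈ s, 1 ≤ a i ∧ x ≤ p i ∧ p i < 1) (j' : ℕ) :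
    DECAt x j' (∑ i ∈ s, a i) (blobLawOn s a p) := by
  obtain ⟨l, hl, hlaw, htop⟩ := exists_blobLaw_eq s a p
  rw [← hlaw, ← htop]
  refine blobDEC_of_sliceClosedWindowT hW x hx0 hx1 l (fun q hq => ?_) j'
  obtain ⟨i, his, e⟩ := hl q hq
  rw [e]
  exact hs i his

/-- **BLOB-DEC(k) ∀k from `ConvClosedT`** (via `sliceClosedWindowT_of_convClosedT`). [this work] -/
theorem blobDEC_of_convClosedT (hC : ConvClosedT) (x : ℝ) (hx0 : 0 < x) (hx1 : x < 1) :
    ∀ (l : List (ℕ × ℝ)), (∀ p ∈ l, 1 ≤ p.1 ∧ x ≤ p.2 ∧ p.2 < 1) → ∀ j', DECAt x j' (blobTop l) (blobLaw l) :=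
  blobDEC_of_sliceClosedWindowT (sliceClosedWindowT_of_convClosedT hC) x hx0 hx1

/-- **BLOB-DEC(k) ∀k, product-Bernoulli form, from `ConvClosedT`.** [this work] -/
theorem blobDEC_on_of_convClosedT {ι : Type} [DecidableEq ι] (hC : ConvClosedT) (x : ℝ) (hx0 : 0 < x) (hx1 : x < 1)
    (s : Finset ι) (a : ι → ℕ) (p : ι → ℝ) (hs : ∀ i ∈ s, 1 ≤ a i ∧ x ≤ p i ∧ p i < 1) (j' : ℕ) :
    DECAt x j' (∑ i ∈ s, a i) (blobLawOn s a p) :=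
  blobDEC_on_of_sliceClosedWindowT (sliceClosedWindowT_of_convClosedT hC) x hx0 hx1 s a p hs j'

end LawDec

end Quant

end Summit.CriticalPhenomena.PercolationContinuityZ3.Theorems
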